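import Summits.QuantumFields.YangMills.Theses.IsotropyFromPowerCounting
import Summits.QuantumFields.YangMills.Theorems.MirrorModularBoostsSoftKernelBoostCovariancePlanarInvariantOfInputs
import Summits.QuantumFields.YangMills.Theorems.MirrorModularBoostsSoftKernelBoostCovarianceStepZeroOfLattice
import HarnessLib

/-!
# `IsotropyFromPowerCounting.EngineFromPowerCounting` — the typed split `T → Σ → B′` (stmt-QuantumFields-17722)

Route `IsotropyFromPowerCounting` files the two Yang–Mills inputs of line `Sketch` of crux
`MirrorModularBoosts.SoftKernelBoostCovariance` (stmt-QuantumFields-14999) as items: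
`TemperedCurvatureMoments` (T, stmt-17721: tempered renormalised lattice moment densities tied to `S₁ n` on
off-diagonal real tensors — verbatim the registered `stub_temperedLatticeApproximants`) and `CurvatureSandwichBound`
(Σ, stmt-18372: the transversely filtered heat-sandwich bound with exponent `μ < 4` for the `e₀`-reconstruction of
`S₁` and of its `45°` pull-back, the rotation being named by its coordinates).  This file proves the item
`EngineFromPowerCounting : TemperedCurvatureMoments → CurvatureSandwichBound → SoftKernelBoostCovariance` from the
LANDED pieces of the line:

* Step 0 pointwise from T by `stub_stepZeroOfLattice` (p137944; it runs the landed analysis halves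
  `BoostsInheritMirrors.stub_dominatedTieLimit` p108509 / `stub_regular_of_dominated` p109000);
* the `45°` frame of Σ instantiated at `planeRot (0 : Fin 3) (π/4)`, whose coordinates are the ones Σ names
  (`planeRot_coords_quarter_pi`);
* the landed composition `cruxOfInputsK` (p136406) of the whole model-blind operator chain and parity sieve.

Also recorded: `curvatureDensities_of_temperedCurvatureMoments : TemperedCurvatureMoments → CurvatureDensities`
(stmt-17723 is Step 0 itself; it follows from T by the same glue) and the old-vocabulary form of Σ
(`sandwichBound_planeRot_of_curvatureSandwichBound`, the registered `stub_sandwichBound` text of the 14999 skeleton).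
-/

noncomputable section

namespace Summit.QuantumFields.YangMills.Theorems.SoftKernelBoostCovariance.Sketch

open scoped BigOperators SchwartzMap
open MeasureTheory Filter Topology
open Literature.MathematicalPhysics.QuantumLattice Literature.MathematicalPhysics.AQFT
  Literature.MathematicalPhysics.QuantumFieldTheory
open Summit.QuantumFields.YangMills.Theorems.NPointIsotropy.Negative (E4 NPointRegular)
open Summit.QuantumFields.YangMills.Theorems.CurvatureBoostCovariance.Negative
  (EightFrameRP PlanarCone W1)

/-- **The coordinates of the `45°` rotation of the `(x₀,x₁)`-plane**: `planeRot (0 : Fin 3) (π/4)` is the isometry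
named in `CurvatureSandwichBound` by `(Rx)₀ = cos(π/4) x₀ + sin(π/4) x₁`, `(Rx)₁ = −sin(π/4) x₀ + cos(π/4) x₁`,
`(Rx)₂ = x₂`, `(Rx)₃ = x₃`. -/
theorem planeRot_coords_quarter_pi (x : E4) :
    planeRot (0 : Fin 3) (Real.pi / 4) x 0 = Real.cos (Real.pi / 4) * x 0 + Real.sin (Real.pi / 4) * x 1 ∧
    planeRot (0 : Fin 3) (Real.pi / 4) x 1 = -Real.sin (Real.pi / 4) * x 0 + Real.cos (Real.pi / 4) * x 1 ∧
    planeRot (0 : Fin 3) (Real.pi / 4) x 2 = x 2 ∧ planeRot (0 : Fin 3) (Real.pi / 4) x 3 = x 3 := by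
  refine ⟨?_, ?_, ?_, ?_⟩ <;> simp [planeRot_apply]

/-- **Σ in the skeleton's vocabulary**: `CurvatureSandwichBound` (the `45°` frame named by coordinates) gives the
registered `stub_sandwichBound` of the 14999 skeleton (the `45°` frame written `planeRot (0 : Fin 3) (π/4)`). -/
theorem sandwichBound_planeRot_of_curvatureSandwichBound
    (hSig : Summit.QuantumFields.YangMills.Theses.IsotropyFromPowerCounting.CurvatureSandwichBound) :
    ∀ (G : Type) [Group G] [TopologicalSpace G] [IsTopologicalGroup G] [CompactSpace G]
      [MeasurableSpace G] [BorelSpace G], IsCompactSimpleLieGroup G →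
      ∀ (r : LatticeRep G) (sch : SpeciesScheme (YMSpecies G)) (S₁ : SchwingerFamily E4),
        W1 r sch S₁ → EightFrameRP S₁ → PlanarCone S₁ →
        (∃ (K : E4 → ℝ) (C η : ℝ), 0 < η ∧ ContinuousOn K {x : E4 | x ≠ 0} ∧
          (∀ x : E4, x ≠ 0 → |K x| ≤ C * (1 + ‖x‖ ^ (η - 10))) ∧
          ∀ F : SchwartzMap (Fin 2 → E4) ℂ, IsOffDiagonal F →
            MeasureTheory.Integrable (fun x : Fin 2 → E4 => (K (x 0 - x 1) : ℂ) * F x) ∧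
              S₁ 2 F = ∫ x : Fin 2 → E4, (K (x 0 - x 1) : ℂ) * F x) →
        (∀ (h : OSReconstructionNoE1 S₁.toLabelled), ∃ μ C : ℝ, μ < 4 ∧
          (∀ (u v : ℝ), 0 < u → 0 < v → u ≤ 1 → v ≤ 1 →
             ∀ (f₁ : SchwartzMap (Fin 1 → E4) ℂ) (g hh : ℝ × ℝ → ℂ) (Mg Mh Mh' : ℝ),
               (∀ x : Fin 1 → E4, f₁ x = g (x 0 0, x 0 1) * hh (x 0 2, x 0 3)) →
               (∀ p : ℝ × ℝ, g p ≠ 0 → u ≤ p.1 ∧ p.1 ≤ 2 * u) →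
               MeasureTheory.Integrable g → (∫ p, ‖g p‖) ≤ Mg →
               MeasureTheory.Integrable hh → (∫ p, ‖hh p‖) ≤ Mh → (∀ p, ‖hh p‖ ≤ Mh') →
             ∀ (n : ℕ) (W : SchwartzMap (Fin n → E4) ℂ) (hW : IsTimeOrdered W)
               (hFW : IsTimeOrdered
                 (SchwartzMap.appendTensor f₁ (translateMulti ((2 * u + v) • EuclideanSpace.single 0 1) W))),
               ‖h.fieldVec (1 + n) (fun _ => ())
                   (SchwartzMap.appendTensor f₁ (translateMulti ((2 * u + v) • EuclideanSpace.single 0 1) W)) hFW‖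
                 ≤ C * Mg * (Mh + Mh') * (u ^ (-μ) + v ^ (-μ)) * ‖h.fieldVec n (fun _ => ()) W hW‖)) ∧
        (∀ (h' : OSReconstructionNoE1 (SchwingerFamily.toLabelled
            (fun n => (S₁ n).comp (linActMulti (planeRot (0 : Fin 3) (Real.pi / 4)))))),
          ∃ μ C : ℝ, μ < 4 ∧
          (∀ (u v : ℝ), 0 < u → 0 < v → u ≤ 1 → v ≤ 1 →
             ∀ (f₁ : SchwartzMap (Fin 1 → E4) ℂ) (g hh : ℝ × ℝ → ℂ) (Mg Mh Mh' : ℝ),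
               (∀ x : Fin 1 → E4, f₁ x = g (x 0 0, x 0 1) * hh (x 0 2, x 0 3)) →
               (∀ p : ℝ × ℝ, g p ≠ 0 → u ≤ p.1 ∧ p.1 ≤ 2 * u) →
               MeasureTheory.Integrable g → (∫ p, ‖g p‖) ≤ Mg →
               MeasureTheory.Integrable hh → (∫ p, ‖hh p‖) ≤ Mh → (∀ p, ‖hh p‖ ≤ Mh') →
             ∀ (n : ℕ) (W : SchwartzMap (Fin n → E4) ℂ) (hW : IsTimeOrdered W)
               (hFW : IsTimeOrdered
                 (SchwartzMap.appendTensor f₁ (translateMulti ((2 * u + v) • EuclideanSpace.single 0 1) W))),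
               ‖h'.fieldVec (1 + n) (fun _ => ())
                   (SchwartzMap.appendTensor f₁ (translateMulti ((2 * u + v) • EuclideanSpace.single 0 1) W)) hFW‖
                 ≤ C * Mg * (Mh + Mh') * (u ^ (-μ) + v ^ (-μ)) * ‖h'.fieldVec n (fun _ => ()) W hW‖)) := by
  intro G _ _ _ _ _ _ hG r sch S₁ hW h8 hC hK
  obtain ⟨h0, h45⟩ := hSig G hG r sch S₁ hW h8 hC hK
  exact ⟨h0, h45 (planeRot (0 : Fin 3) (Real.pi / 4)) planeRot_coords_quarter_pi⟩

/-- **Step 0 from T** (the item `CurvatureDensities`, stmt-QuantumFields-17723, is Step 0 itself; it is a corollary of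
`TemperedCurvatureMoments` by the landed pointwise glue `stub_stepZeroOfLattice`, with E0 from `W1`). -/
theorem curvatureDensities_of_temperedCurvatureMoments
    (hT : Summit.QuantumFields.YangMills.Theses.IsotropyFromPowerCounting.TemperedCurvatureMoments) :
    Summit.QuantumFields.YangMills.Theses.IsotropyFromPowerCounting.CurvatureDensities := by
  intro G _ _ _ _ _ _ hG r sch S₁ hW h8 hC
  exact stub_stepZeroOfLattice sch.a sch.L S₁ sch.a_pos sch.tendsto_a sch.tendsto_L hW.2.1.1
    (fun n hn => hT G hG r sch S₁ hW h8 hC n hn)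

/-- **THE TYPED SPLIT `T → Σ → B′`** — the item `IsotropyFromPowerCounting.EngineFromPowerCounting`
(stmt-QuantumFields-17722): `TemperedCurvatureMoments → CurvatureSandwichBound → MirrorModularBoosts.SoftKernelBoostCovariance`,
by the landed composition `cruxOfInputsK` (Step 0 with the idle kernel antecedent, fed by T through
`stub_stepZeroOfLattice`; Σ in `planeRot` vocabulary by `sandwichBound_planeRot_of_curvatureSandwichBound`). -/
theorem engineFromPowerCounting_proof :
    Summit.QuantumFields.YangMills.Theses.IsotropyFromPowerCounting.EngineFromPowerCounting := by
  intro hT hSig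
  refine cruxOfInputsK (fun G _ _ _ _ _ _ hG r sch S₁ hW h8 hC _ => ?_)
    (sandwichBound_planeRot_of_curvatureSandwichBound hSig)
  exact curvatureDensities_of_temperedCurvatureMoments hT G hG r sch S₁ hW h8 hC

end Summit.QuantumFields.YangMills.Theorems.SoftKernelBoostCovariance.Sketch

end
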